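import Literature.NumberTheory.LFunctions.WeilTwoPrimeDeflM75YBase
import Literature.NumberTheory.LFunctions.WeilBlockRowsFast
import HarnessLib

/-!
# Deflated two-prime certificate (weilCertDeflM75Y): the Bessel block claim `Hp = C H Cᵀ` (parity 1), rows 75–79, fast check

`WeilCert.checkHpRowT` (linear traversals) instead of the indexed `checkHpRow` decide.  Pure proof file.
-/

noncomputable section

namespace Summit.RiemannHypothesis.RiemannHypothesis.Theorems.EvenWinsBeyondArch

open Literature.NumberTheory.LFunctions

set_option maxHeartbeats 0 in
/-- Fast kernel check of claim row 75 of `Hp = C H Cᵀ` (parity 1; linear traversals, triangular `C`). [folklore] -/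
theorem checkHpRowT1_75_weilCertDeflM75Y : weilCertDeflM75YBase.checkHpRowT weilCertDeflM75YHpO 1 75 = true := by
  decide +kernel

/-- Claim row 75 of `Hp = C H Cᵀ` (parity 1), from the fast check. [folklore] -/
theorem checkHpRow1_75_weilCertDeflM75Y : weilCertDeflM75YBase.checkHpRow weilCertDeflM75YHpO 1 75 = true :=
  WeilCert.checkHpRow_of_T checkHpRowT1_75_weilCertDeflM75Y

set_option maxHeartbeats 0 in
/-- Fast kernel check of claim row 76 of `Hp = C H Cᵀ` (parity 1; linear traversals, triangular `C`). [folklore] -/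
theorem checkHpRowT1_76_weilCertDeflM75Y : weilCertDeflM75YBase.checkHpRowT weilCertDeflM75YHpO 1 76 = true := by
  decide +kernel

/-- Claim row 76 of `Hp = C H Cᵀ` (parity 1), from the fast check. [folklore] -/
theorem checkHpRow1_76_weilCertDeflM75Y : weilCertDeflM75YBase.checkHpRow weilCertDeflM75YHpO 1 76 = true :=
  WeilCert.checkHpRow_of_T checkHpRowT1_76_weilCertDeflM75Y

set_option maxHeartbeats 0 in
/-- Fast kernel check of claim row 77 of `Hp = C H Cᵀ` (parity 1; linear traversals, triangular `C`). [folklore] -/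
theorem checkHpRowT1_77_weilCertDeflM75Y : weilCertDeflM75YBase.checkHpRowT weilCertDeflM75YHpO 1 77 = true := by
  decide +kernel

/-- Claim row 77 of `Hp = C H Cᵀ` (parity 1), from the fast check. [folklore] -/
theorem checkHpRow1_77_weilCertDeflM75Y : weilCertDeflM75YBase.checkHpRow weilCertDeflM75YHpO 1 77 = true :=
  WeilCert.checkHpRow_of_T checkHpRowT1_77_weilCertDeflM75Y

set_option maxHeartbeats 0 in
/-- Fast kernel check of claim row 78 of `Hp = C H Cᵀ` (parity 1; linear traversals, triangular `C`). [folklore] -/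
theorem checkHpRowT1_78_weilCertDeflM75Y : weilCertDeflM75YBase.checkHpRowT weilCertDeflM75YHpO 1 78 = true := by
  decide +kernel

/-- Claim row 78 of `Hp = C H Cᵀ` (parity 1), from the fast check. [folklore] -/
theorem checkHpRow1_78_weilCertDeflM75Y : weilCertDeflM75YBase.checkHpRow weilCertDeflM75YHpO 1 78 = true :=
  WeilCert.checkHpRow_of_T checkHpRowT1_78_weilCertDeflM75Y

set_option maxHeartbeats 0 in
/-- Fast kernel check of claim row 79 of `Hp = C H Cᵀ` (parity 1; linear traversals, triangular `C`). [folklore] -/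
theorem checkHpRowT1_79_weilCertDeflM75Y : weilCertDeflM75YBase.checkHpRowT weilCertDeflM75YHpO 1 79 = true := by
  decide +kernel

/-- Claim row 79 of `Hp = C H Cᵀ` (parity 1), from the fast check. [folklore] -/
theorem checkHpRow1_79_weilCertDeflM75Y : weilCertDeflM75YBase.checkHpRow weilCertDeflM75YHpO 1 79 = true :=
  WeilCert.checkHpRow_of_T checkHpRowT1_79_weilCertDeflM75Y

end Summit.RiemannHypothesis.RiemannHypothesis.Theorems.EvenWinsBeyondArch
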